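import Literature.AnabelianGeometry.SemiGraphs.PSCVerticialRamificationTransportProofs
import Mathlib.GroupTheory.PGroup
import HarnessLib

/-!
# The transport along `β : Π^unr_G ⥲ Π^unr_H` is a lattice isomorphism ([CombGC] Def. 1.4; Thm. 1.6 (iii))

Mochizuki, *A combinatorial version of the Grothendieck conjecture*, Tohoku Math. J. **59** (2007)
[CombGC], Definition 1.4 (iii)/(iv) for an isomorphism `β : Π^unr_G ⥲ Π^unr_H` (author's ms pp. 10–11),
and the proof of Theorem 1.6 (iii) as amended by [IUTchI] Remark 1.2.3 (vii) (kurims p. 43):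
"necessity follows formally from the characterization of unramified verticial subgroups … and the
characterization of verticially purely totally ramified finite étale coverings".  The word
"formally" refers to the fact that every group-theoretic datum attached to a `Π^unr_G`-covering —
the lattice of intermediate subgroups, indices, normalizers, `l`-th powers, the commutator subgroup —
is carried by `β` to the corresponding datum on the `Π^unr_H`-side.  Over abc-iut-L3-t4's interface
(`PSCGraphicity.lean`: `unrTransport G H β S` = the subgroup of `Π_H` over `β(S · Ker / Ker)`) this
proof-only file (abc-iut cell, sub-DAG row CombGC:Thm1.6(iii)/T16-L16) records that calculus,
extending §3 of `PSCUnrVerticialLevelwiseProofs.lean` and `PSCVerticialRamificationTransportProofs.lean`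
(abc-iut-L5-t6: `unrTransport_top`, `index_unrTransport`, …):

* `unrTransport_inf`, `unrTransport_le_iff`, `unrTransport_inj`, `unrTransport_eq_iff_eq_symm` —
  the transport is an isomorphism of the lattices of subgroups containing the kernels
  `Ker(Π ↠ Π^unr)`;
* `relIndex_unrTransport` — relative indices `[U : H']` are preserved; `relIndex_eq_prime_pow_of_pow_mem`
  — the kernel `H' ⊊ U` of an elementary abelian quotient of exponent `l` has index `l^k`, `k ≥ 1`;
* `unrTransport_normalizer` — normalizers are preserved;
* `pow_mem_unrTransport_iff` — "`u^l ∈ H'` for all `u ∈ U`" is preserved;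
* `unrTransport_topologicalClosure`, `unrTransport_commutator_sup_unrKer` — topological closures and
  `[U, U] · Ker` are preserved (so the kernel `E^unr` of `Π_{G_U} ↠ M^unr_{G_U}` is carried to that of
  `H_{β U}`);
* `IsUnrVerticiallyFiltrationPreserving.symm` — Def. 1.4 (iii) for `β` implies it for `β⁻¹`.

Plain group theory / topology; 0 defs; no statement of [CombGC]/[IUTchI] is asserted; nothing here
takes a side on [IUTchIII] Cor. 3.12. [cite: MochizukiCombGC2007, Def 1.4(iii) p.10]
-/

noncomputable section

namespace Literature.AnabelianGeometry.SemiGraphs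

namespace PSCDatum

open scoped Pointwise

universe u

variable {P : Type u} [Group P] [TopologicalSpace P] [IsTopologicalGroup P]
variable {P' : Type u} [Group P'] [TopologicalSpace P'] [IsTopologicalGroup P']
variable (G : PSCDatum P) (H : PSCDatum P') (β : (P ⧸ G.unrKer) ≃ₜ* (P' ⧸ H.unrKer))

/-! ### 1. Group-theoretic preliminaries -/

omit [TopologicalSpace P] [IsTopologicalGroup P] [TopologicalSpace P'] [IsTopologicalGroup P'] in
/-- `f(S ∩ T) = f(S) ∩ f(T)` when `Ker f ⊆ S`. [folklore] -/
private theorem map_inf_of_ker_le {A B : Type*} [Group A] [Group B] (f : A →* B) {S T : Subgroup A}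
    (h : f.ker ≤ S) : (S ⊓ T).map f = S.map f ⊓ T.map f := by
  refine le_antisymm (Subgroup.map_inf_le _ _ _) ?_
  rintro x ⟨⟨s, hs, hsx⟩, ⟨t, ht, htx⟩⟩
  refine ⟨t, ⟨?_, ht⟩, htx⟩
  have hst : s⁻¹ * t ∈ f.ker := by
    rw [MonoidHom.mem_ker, map_mul, map_inv, hsx, htx, inv_mul_cancel]
  simpa using S.mul_mem hs (h hst)

/-- The image of `S` in `Π^unr_G` only depends on `S · Ker`. [cite: MochizukiCombGC2007, Def 1.4(iii) p.10] -/
theorem unrTransport_sup_unrKer (S : Subgroup P) :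
    G.unrTransport H β (S ⊔ G.unrKer) = G.unrTransport H β S := by
  unfold unrTransport
  have h0 : (G.unrKer).map (QuotientGroup.mk' G.unrKer) = ⊥ :=
    (Subgroup.map_eq_bot_iff _).mpr (by rw [QuotientGroup.ker_mk'])
  rw [Subgroup.map_sup, h0, sup_bot_eq]

/-! ### 2. The transport is a lattice isomorphism on subgroups containing the kernels -/

/-- The transport preserves intersections with a subgroup containing `Ker(Π_G ↠ Π^unr_G)`.
[cite: MochizukiCombGC2007, Def 1.4(iii) p.10] -/
theorem unrTransport_inf {S₁ : Subgroup P} (h₁ : G.unrKer ≤ S₁) (S₂ : Subgroup P) :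
    G.unrTransport H β (S₁ ⊓ S₂) = G.unrTransport H β S₁ ⊓ G.unrTransport H β S₂ := by
  unfold unrTransport
  have hker : (QuotientGroup.mk' G.unrKer).ker ≤ S₁ := by rwa [QuotientGroup.ker_mk']
  rw [map_inf_of_ker_le _ hker, Subgroup.map_inf _ _ _ β.injective, Subgroup.comap_inf]

/-- The transport reflects and preserves inclusions (target containing the kernel).
[cite: MochizukiCombGC2007, Def 1.4(iii) p.10] -/
theorem unrTransport_le_iff {S₁ S₂ : Subgroup P} (h₂ : G.unrKer ≤ S₂) :
    G.unrTransport H β S₁ ≤ G.unrTransport H β S₂ ↔ S₁ ≤ S₂ := by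
  refine ⟨fun h => ?_, fun h => G.unrTransport_mono H β h⟩
  have h' := H.unrTransport_mono G β.symm h
  rw [G.unrTransport_symm_unrTransport H β h₂, ← G.unrTransport_sup_unrKer H β S₁,
    G.unrTransport_symm_unrTransport H β le_sup_right] at h'
  exact le_sup_left.trans h'

/-- The transport is injective on subgroups containing the kernel.
[cite: MochizukiCombGC2007, Def 1.4(iii) p.10] -/
theorem unrTransport_inj {S₁ S₂ : Subgroup P} (h₁ : G.unrKer ≤ S₁) (h₂ : G.unrKer ≤ S₂) :
    G.unrTransport H β S₁ = G.unrTransport H β S₂ ↔ S₁ = S₂ := by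
  refine ⟨fun h => le_antisymm ?_ ?_, fun h => h ▸ rfl⟩
  · exact (G.unrTransport_le_iff H β h₂).mp h.le
  · exact (G.unrTransport_le_iff H β h₁).mp h.ge

/-- `β` carries `S` to `S'` iff `β⁻¹` carries `S'` to `S` (both containing the kernels).
[cite: MochizukiCombGC2007, Def 1.4(iii) p.10] -/
theorem unrTransport_eq_iff_eq_symm {S : Subgroup P} {S' : Subgroup P'} (hS : G.unrKer ≤ S)
    (hS' : H.unrKer ≤ S') :
    G.unrTransport H β S = S' ↔ S = H.unrTransport G β.symm S' := by
  constructor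
  · rintro rfl
    exact (G.unrTransport_symm_unrTransport H β hS).symm
  · rintro rfl
    exact G.unrTransport_unrTransport_symm H β hS'

/-- A transported subgroup is a proper subgroup of `β U` iff the original is a proper subgroup of
`U`. [cite: MochizukiCombGC2007, Def 1.4(iii) p.10] -/
theorem unrTransport_ne_iff {S₁ S₂ : Subgroup P} (h₁ : G.unrKer ≤ S₁) (h₂ : G.unrKer ≤ S₂) :
    G.unrTransport H β S₁ ≠ G.unrTransport H β S₂ ↔ S₁ ≠ S₂ :=
  (G.unrTransport_inj H β h₁ h₂).not

/-! ### 3. Indices, normalizers, `l`-th powers -/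

omit [TopologicalSpace P] [IsTopologicalGroup P] [TopologicalSpace P'] [IsTopologicalGroup P'] in
/-- Relative indices are computed after a surjection when the smaller group contains the kernel.
[folklore] -/
private theorem relIndex_comap_comap_of_surjective {A B : Type*} [Group A] [Group B] (f : A →* B)
    (hf : Function.Surjective f) (S T : Subgroup B) :
    (S.comap f).relIndex (T.comap f) = S.relIndex T := by
  rw [Subgroup.relIndex_comap, Subgroup.map_comap_eq_self_of_surjective hf]

/-- **Indices are preserved by the transport**: `[β U : β H'] = [U : H']` for
`Ker ⊆ H'` (no inclusion `H' ⊆ U` needed). [cite: MochizukiCombGC2007, Def 1.4(iii) p.10] -/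
theorem relIndex_unrTransport {H' : Subgroup P} (hH' : G.unrKer ≤ H') (U : Subgroup P) :
    (G.unrTransport H β H').relIndex (G.unrTransport H β U) = H'.relIndex U := by
  unfold unrTransport
  have hker : (QuotientGroup.mk' G.unrKer).ker ≤ H' := by rwa [QuotientGroup.ker_mk']
  rw [relIndex_comap_comap_of_surjective _ (QuotientGroup.mk'_surjective _),
    Subgroup.relIndex_map_map_of_injective _ _ β.injective]
  conv_rhs => rw [← Subgroup.comap_map_eq_self hker, Subgroup.relIndex_comap]

omit [TopologicalSpace P] [IsTopologicalGroup P] in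
/-- A subgroup `V` with `[U, U] ⊆ V` is normalised by `U`: `V ∩ U` is normal in `U` (so every subgroup
between `closure([U,U]·Ker)` and `U` is the kernel of a quotient of `M^unr_{G_U} = (U/Ker)^ab`, [IUTchI] Rmk.
1.2.3 (iv) p. 42 "we identify such quotients whenever their kernels coincide").
[cite: Mochizuki2012, IUTchI Rmk 1.2.3(iv) p.42] -/
theorem subgroupOf_normal_of_commutator_le {U V : Subgroup P} (h : ⁅U, U⁆ ≤ V) :
    (V.subgroupOf U).Normal := by
  refine ⟨fun v hv u => ?_⟩
  rw [Subgroup.mem_subgroupOf] at hv ⊢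
  have hc : (u : P) * v * (u : P)⁻¹ * (v : P)⁻¹ ∈ V := h (Subgroup.commutator_mem_commutator u.2 v.2)
  simpa using V.mul_mem hc hv

omit [IsTopologicalGroup P] in
/-- **The kernel `H' ⊊ U` of a nontrivial elementary abelian quotient of exponent `l` (prime) of an open
subgroup `U` of a compact group has index `[U : H'] = l^k` with `k ≥ 1`** — the covering
`G_{H'} → G_U` is "Galois of degree a positive power of `l`" ([IUTchI] Rmk. 1.2.3 (iii), p. 41).
[cite: Mochizuki2012, IUTchI Rmk 1.2.3(iii) p.41] -/
theorem relIndex_eq_prime_pow_of_pow_mem [IsTopologicalGroup P] [CompactSpace P] {U H' : Subgroup P}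
    {l : ℕ} (hl : l.Prime) (hne : H' ≠ U) (hle : H' ≤ U) (hopen : IsOpen (H' : Set P))
    (hcomm : ⁅U, U⁆ ≤ H') (hpow : ∀ u ∈ U, u ^ l ∈ H') :
    ∃ k : ℕ, 0 < k ∧ H'.relIndex U = l ^ k := by
  haveI : Fact l.Prime := ⟨hl⟩
  haveI := subgroupOf_normal_of_commutator_le hcomm
  haveI : H'.FiniteIndex := finiteIndex_of_isOpen H' hopen
  haveI : (H'.subgroupOf U).FiniteIndex := inferInstance
  have hp : IsPGroup l (U ⧸ H'.subgroupOf U) := by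
    intro q
    induction q using QuotientGroup.induction_on with
    | H u =>
      refine ⟨1, ?_⟩
      rw [pow_one, ← QuotientGroup.mk_pow, QuotientGroup.eq_one_iff, Subgroup.mem_subgroupOf,
        Subgroup.coe_pow]
      exact hpow u u.2
  obtain ⟨k, hk⟩ := IsPGroup.iff_card.mp hp
  refine ⟨k, Nat.pos_of_ne_zero ?_, ?_⟩
  · rintro rfl
    rw [pow_zero, ← Subgroup.index_eq_card, Subgroup.index_eq_one, Subgroup.subgroupOf_eq_top] at hk
    exact hne (le_antisymm hle hk)
  · rw [Subgroup.relIndex, Subgroup.index_eq_card, hk]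

/-- **Normalizers are preserved by the transport** (for subgroups containing the kernel).
[cite: MochizukiCombGC2007, Def 1.4(iii) p.10] -/
theorem unrTransport_normalizer {K : Subgroup P} (hK : G.unrKer ≤ K) :
    G.unrTransport H β (Subgroup.normalizer (K : Set P)) =
      Subgroup.normalizer (G.unrTransport H β K : Set P') := by
  unfold unrTransport
  have hker : (QuotientGroup.mk' G.unrKer).ker ≤ K := by rwa [QuotientGroup.ker_mk']
  -- `π_G (N(K)) = N(π_G K)` since `K = π_G⁻¹(π_G K)`
  have h1 : (Subgroup.normalizer (K : Set P)).map (QuotientGroup.mk' G.unrKer) =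
      Subgroup.normalizer ((K.map (QuotientGroup.mk' G.unrKer) : Subgroup (P ⧸ G.unrKer)) :
        Set (P ⧸ G.unrKer)) := by
    conv_lhs => rw [← Subgroup.comap_map_eq_self hker]
    rw [← Subgroup.comap_normalizer_eq_of_surjective _ (QuotientGroup.mk'_surjective _),
      Subgroup.map_comap_eq_self_of_surjective (QuotientGroup.mk'_surjective _)]
  rw [h1, Subgroup.map_equiv_normalizer_eq,
    Subgroup.comap_normalizer_eq_of_surjective _ (QuotientGroup.mk'_surjective _)]

/-- "`u ^ l ∈ H'` for every `u ∈ U`" is carried by the transport (one direction).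
[cite: MochizukiCombGC2007, Def 1.4(iii) p.10] -/
theorem pow_mem_unrTransport_of {U H' : Subgroup P} {l : ℕ} (h : ∀ u ∈ U, u ^ l ∈ H') :
    ∀ u' ∈ G.unrTransport H β U, u' ^ l ∈ G.unrTransport H β H' := by
  intro u' hu'
  obtain ⟨u, hu, huu'⟩ := (G.mem_unrTransport_iff H β).mp hu'
  refine (G.mem_unrTransport_iff H β).mpr ⟨u ^ l, h u hu, ?_⟩
  rw [QuotientGroup.mk_pow, map_pow, huu', QuotientGroup.mk_pow]

/-- **"`u ^ l ∈ H'` for every `u ∈ U`" is preserved by the transport** (for `U`, `H'` containing the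
kernel). [cite: MochizukiCombGC2007, Def 1.4(iii) p.10] -/
theorem pow_mem_unrTransport_iff {U H' : Subgroup P} (hU : G.unrKer ≤ U) (hH' : G.unrKer ≤ H')
    (l : ℕ) :
    (∀ u' ∈ G.unrTransport H β U, u' ^ l ∈ G.unrTransport H β H') ↔ ∀ u ∈ U, u ^ l ∈ H' := by
  refine ⟨fun h => ?_, G.pow_mem_unrTransport_of H β⟩
  have h' := H.pow_mem_unrTransport_of G β.symm h
  rwa [G.unrTransport_symm_unrTransport H β hU, G.unrTransport_symm_unrTransport H β hH'] at h'

/-! ### 4. Topological closures and the commutator subgroup -/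

/-- **The transport commutes with topological closure** for subgroups containing the kernel
(the projections `Π ↠ Π^unr` are open quotient maps and `β` is a homeomorphism).
[cite: MochizukiCombGC2007, Def 1.4(iii) p.10] -/
theorem unrTransport_topologicalClosure {S : Subgroup P} (hS : G.unrKer ≤ S) :
    G.unrTransport H β S.topologicalClosure = (G.unrTransport H β S).topologicalClosure := by
  apply SetLike.coe_injective
  rw [G.coe_unrTransport H β, Subgroup.topologicalClosure_coe, Subgroup.topologicalClosure_coe,
    G.coe_unrTransport H β]
  -- closure commutes with the open quotient map `Π_G ↠ Π^unr_G` on the saturated set `S`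
  have h1 : QuotientGroup.mk '' closure (S : Set P) =
      closure (QuotientGroup.mk '' (S : Set P) : Set (P ⧸ G.unrKer)) := by
    refine Set.Subset.antisymm
      (image_closure_subset_closure_image QuotientGroup.continuous_mk) ?_
    have hsat : QuotientGroup.mk ⁻¹' (QuotientGroup.mk '' (S : Set P) : Set (P ⧸ G.unrKer)) =
        (S : Set P) := by
      ext x
      simp only [Set.mem_preimage, Set.mem_image, SetLike.mem_coe]
      constructor
      · rintro ⟨s, hs, hsx⟩
        have : s⁻¹ * x ∈ G.unrKer := QuotientGroup.eq.mp hsx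
        simpa using S.mul_mem hs (hS this)
      · exact fun hx => ⟨x, hx, rfl⟩
    have h2 : closure (QuotientGroup.mk '' (S : Set P) : Set (P ⧸ G.unrKer)) ⊆
        QuotientGroup.mk '' (QuotientGroup.mk ⁻¹'
          closure (QuotientGroup.mk '' (S : Set P) : Set (P ⧸ G.unrKer))) := by
      rw [Set.image_preimage_eq _ QuotientGroup.mk_surjective]
    refine h2.trans (Set.image_mono ?_)
    rw [(QuotientGroup.isOpenMap_coe (N := G.unrKer)).preimage_closure_eq_closure_preimage
      QuotientGroup.continuous_mk, hsat]
  have h2 : ∀ s : Set (P ⧸ G.unrKer),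
      (β : P ⧸ G.unrKer → P' ⧸ H.unrKer) '' closure s = closure (β '' s) :=
    fun s => β.toHomeomorph.image_closure s
  rw [h1, h2]
  exact ((QuotientGroup.isOpenMap_coe (N := H.unrKer)).preimage_closure_eq_closure_preimage
    QuotientGroup.continuous_mk _)

/-- **The transport of `[U, U] · Ker(Π_G ↠ Π^unr_G)` is `[β U, β U] · Ker(Π_H ↠ Π^unr_H)`**.
[cite: MochizukiCombGC2007, Def 1.4(iii) p.10] -/
theorem unrTransport_commutator_sup_unrKer (U : Subgroup P) :
    G.unrTransport H β (⁅U, U⁆ ⊔ G.unrKer) =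
      ⁅G.unrTransport H β U, G.unrTransport H β U⁆ ⊔ H.unrKer := by
  rw [G.unrTransport_sup_unrKer H β]
  unfold unrTransport
  rw [Subgroup.map_commutator, Subgroup.map_commutator]
  -- `π_H⁻¹ ⁅A, A⁆ = ⁅π_H⁻¹ A, π_H⁻¹ A⁆ ⊔ Ker_H` for `A = β π_G U`, as `A = π_H (π_H⁻¹ A)`
  set A := (U.map (QuotientGroup.mk' G.unrKer)).map β.toMulEquiv.toMonoidHom with hA
  have hAA : A = (A.comap (QuotientGroup.mk' H.unrKer)).map (QuotientGroup.mk' H.unrKer) :=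
    (Subgroup.map_comap_eq_self_of_surjective (QuotientGroup.mk'_surjective _) A).symm
  conv_lhs => rw [hAA, ← Subgroup.map_commutator, Subgroup.comap_map_eq, QuotientGroup.ker_mk']

/-- The transport of the closed subgroup `closure([U, U] · Ker)` — the kernel `E^unr` of
`Π_{G_U} ↠ M^unr_{G_U}` for a `Π^unr_G`-covering `G_U` ([IUTchI] Rmk. 1.2.3 (iv) p. 42 "write
`M^unr_G` for the abelianization of `Π^unr_G`") — is the corresponding kernel on the `H`-side.
[cite: Mochizuki2012, IUTchI Rmk 1.2.3(iv) p.42] -/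
theorem unrTransport_commutator_closure (U : Subgroup P) :
    G.unrTransport H β (⁅U, U⁆ ⊔ G.unrKer).topologicalClosure =
      (⁅G.unrTransport H β U, G.unrTransport H β U⁆ ⊔ H.unrKer).topologicalClosure := by
  rw [G.unrTransport_topologicalClosure H β le_sup_right, G.unrTransport_commutator_sup_unrKer H β]

/-! ### 5. Filtration preservation is symmetric -/

/-- **Def. 1.4 (iii) for `β` implies Def. 1.4 (iii) for `β⁻¹`.**
[cite: MochizukiCombGC2007, Def 1.4(iii) p.10] -/
theorem IsUnrVerticiallyFiltrationPreserving.symm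
    (h : G.IsUnrVerticiallyFiltrationPreserving H β) :
    H.IsUnrVerticiallyFiltrationPreserving G β.symm := by
  intro U' hU'o hKU'
  have hUo := H.isOpen_unrTransport G β.symm hU'o
  have hKU := H.unrKer_le_unrTransport G β.symm U'
  have h1 := h _ hUo hKU
  rw [G.unrTransport_unrTransport_symm H β hKU'] at h1
  rw [← h1, G.unrTransport_symm_unrTransport H β (G.unrKer_le_vertFil hKU)]

/-! ### 6. Kernels of nontrivial elementary abelian quotients of `M^unr_{G_U}` are carried to the same -/

/-- **Transport of "`H'` is the kernel in `Π_{G_U} = U` of a nontrivial elementary abelian quotient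
`M^unr_{G_U} ↠ Q` of exponent `l`"** ([IUTchI] Rmk. 1.2.3 (iv), p. 42: "`φ : M^unr_G ↠ Q` … where `Q`
is an elementary abelian group … we identify such quotients whenever their kernels coincide", applied
to the `Π^unr_G`-covering `G_U`; over the interface: `H' ⊊ U` open with
`closure([U,U] · Ker) ⊆ H'` and `u^l ∈ H'` for `u ∈ U`): the transported `β H'` is such a kernel for
`H_{β U}`. [cite: Mochizuki2012, IUTchI Rmk 1.2.3(iv) p.42] -/
theorem elemAbKernel_unrTransport {U H' : Subgroup P} {l : ℕ} (hKU : G.unrKer ≤ U)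
    (h : H' ≤ U ∧ H' ≠ U ∧ IsOpen (H' : Set P) ∧ (⁅U, U⁆ ⊔ G.unrKer).topologicalClosure ≤ H' ∧
      ∀ u ∈ U, u ^ l ∈ H') :
    G.unrTransport H β H' ≤ G.unrTransport H β U ∧
      G.unrTransport H β H' ≠ G.unrTransport H β U ∧
      IsOpen (G.unrTransport H β H' : Set P') ∧
      (⁅G.unrTransport H β U, G.unrTransport H β U⁆ ⊔ H.unrKer).topologicalClosure ≤
        G.unrTransport H β H' ∧
      ∀ u' ∈ G.unrTransport H β U, u' ^ l ∈ G.unrTransport H β H' := by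
  obtain ⟨hle, hne, hopen, hE, hpow⟩ := h
  have hKH' : G.unrKer ≤ H' :=
    (le_sup_right.trans (Subgroup.le_topologicalClosure _)).trans hE
  refine ⟨G.unrTransport_mono H β hle, (G.unrTransport_ne_iff H β hKH' hKU).mpr hne,
    G.isOpen_unrTransport H β hopen, ?_, G.pow_mem_unrTransport_of H β hpow⟩
  rw [← G.unrTransport_commutator_closure H β U]
  exact G.unrTransport_mono H β hE

/-- The converse transport: a kernel of a nontrivial elementary abelian quotient of `M^unr_{H_{β U}}`
comes from one of `M^unr_{G_U}` (apply `elemAbKernel_unrTransport` to `β⁻¹`).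
[cite: Mochizuki2012, IUTchI Rmk 1.2.3(iv) p.42] -/
theorem elemAbKernel_of_unrTransport {U : Subgroup P} {H₁ : Subgroup P'} {l : ℕ} (hKU : G.unrKer ≤ U)
    (h : H₁ ≤ G.unrTransport H β U ∧ H₁ ≠ G.unrTransport H β U ∧ IsOpen (H₁ : Set P') ∧
      (⁅G.unrTransport H β U, G.unrTransport H β U⁆ ⊔ H.unrKer).topologicalClosure ≤ H₁ ∧
      ∀ u' ∈ G.unrTransport H β U, u' ^ l ∈ H₁) :
    H.unrTransport G β.symm H₁ ≤ U ∧ H.unrTransport G β.symm H₁ ≠ U ∧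
      IsOpen (H.unrTransport G β.symm H₁ : Set P) ∧
      (⁅U, U⁆ ⊔ G.unrKer).topologicalClosure ≤ H.unrTransport G β.symm H₁ ∧
      (∀ u ∈ U, u ^ l ∈ H.unrTransport G β.symm H₁) ∧
      G.unrTransport H β (H.unrTransport G β.symm H₁) = H₁ := by
  have hKU' : H.unrKer ≤ G.unrTransport H β U := G.unrKer_le_unrTransport H β U
  have hKH₁ : H.unrKer ≤ H₁ :=
    (le_sup_right.trans (Subgroup.le_topologicalClosure _)).trans h.2.2.2.1
  have h' := H.elemAbKernel_unrTransport G β.symm hKU' h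
  rw [G.unrTransport_symm_unrTransport H β hKU] at h'
  exact ⟨h'.1, h'.2.1, h'.2.2.1, h'.2.2.2.1, h'.2.2.2.2, G.unrTransport_unrTransport_symm H β hKH₁⟩

end PSCDatum

end Literature.AnabelianGeometry.SemiGraphs

end
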